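/-
Copyright (c) 2026 the pub-hodgecm-mathlib formalisation cell (harness21).  Prover seat hodgecm-mathlib-LH4-p13 (g5), req620 Track A «(D-RAM) FOUR-FRAME» squad, unit U2H:
the (ρ2b′-X) child `stub_U2H_fixedPointCensus_typeTwo_unit0` (U2H ED. 15 :418) — organ O-Sign, the CLASS-FREE letter (descent types U ∕ RK ∕ RM alike).  2026-09-04.
-/
import Summits.HodgeConjecture.HodgeConjecture.Theorems.F0P3cDyRamTokenSignUnr            -- ★ p857454 (this seat): §1–§4 (√θ, descent, (y,θ)=1 near 1, norm-one √)
import Literature.NumberTheory.QuadraticForms.HilbertSymbolUnramifiedClassSub             -- ★ p857408 + ED. 2 p857533 (this seat): `hilbertSymbol_sub_eq_mul_of_sqClass`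
import HarnessLib

/-!
# Crux `H413`, line LH4 «(D-RAM) FOUR-FRAME» — unit U2H, (ρ2b′-X): organ O-Sign, CLASS-FREE FORM — `(β, θ)_v = (a, −θ)_v · (x, a)_v`

Cell `hodgecm-mathlib` (D-0151), FLOOR 0, crux item H413 = `stmt-HodgeConjecture-24833`, route of record `HCCMUnconditional`; squad F0∕P3c∕LH4; registered stub served:
`F0P3cDyRamFourFrameU2H.stub_U2H_fixedPointCensus_typeTwo_unit0` ((ρ2b′-X), U2H ED. 15 :418), through LH4-p14's ★ spine ∕ HEAD-OF-ORGANS.  THEOREMS ONLY (no `def`, no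
instance, no notation, no `sorry`); lane `--supports stmt-HodgeConjecture-24833` (count-neutral).
THE MATHEMATICS.  ★ `F0P3cDyRamTokenSignUnr` factors the ★ p856257 token as `β = x·y` with `ι x = −χ∕(uδ)` (the depth token), `(y, θ)_v = 1` deep, and `x = a − θc²` with
`ι a = (u² + D − χ)∕(uδ) − 2 = Tr_{K∕F}λ′ − 2`; the general symbol identity ★ `hilbertSymbol_sub_eq_mul_of_sqClass` then gives, for a deep type-(2) `γ_H` of ANY descent class,
  **`(β, θ)_v = (a, −θ)_v · (x, a)_v`**  (`hilbertSymbol_token_eq_mul`),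
where `(x, a)_v` is the norm-residue of the depth token for the DESCENT FIELD `K_γ = L⁺_v(λ′) = L⁺_v(√(a(a+4)))` and `(a, −θ)_v` a constant of the pair (class of `K_γ`, `θ`).  Type U
(`K_γ` unramified): `(a, −θ) = (−1)^{v θ}`, `(x, a) = (−1)^{v x} = (−1)^m` — ★ `hilbertSymbol_token_eq_neg_one_pow`; types RK∕RM (`K_γ` ramified): `(x, a)_v` is a genuine K-side sign, the
letter the T5s-RamK∕RamM census must carry as its `ε`.  No hypothesis `hA`, no `m`-token, no ramification hypothesis on `w` beyond the datum.
HONEST LABEL.  Count-neutral helper; (ρ2b′-X) OPEN; `HC_CM` is proved only modulo the 7 printed citations (2 remaining named inputs: hLiu418 = `stmt-HodgeConjecture-24832`, h413 =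
`stmt-HodgeConjecture-24833`) until rung 0 closes.

## References
* [Rogawski1990] J. D. Rogawski, *Automorphic Representations of Unitary Groups in Three Variables*, Ann. of Math. Stud. 123 (1990), §4.9 p. 55, Lemma 4.9.3 p. 56.
* [LabesseLanglands1979] J.-P. Labesse, R. P. Langlands, *L-indistinguishability for SL(2)*, Canad. J. Math. 31 (1979), §2 (2.1)–(2.2).
* [Omeara1963] O. T. O'Meara, *Introduction to Quadratic Forms*, Grundlehren 117 (1963), §63B (63:10–63:13a).
-/

set_option autoImplicit false

noncomputable section

open NumberField IsDedekindDomain WithZero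
open Literature.NumberTheory.Automorphic Literature.NumberTheory.Automorphic.UnitaryGroup Literature.NumberTheory.GaloisRepresentations
open Literature.NumberTheory.QuadraticForms Literature.NumberTheory.Rogawski1990
open Literature.NumberTheory.Automorphic.UnitaryThreeFourFrame Literature.NumberTheory.LocalFields.WildQuadraticDatum
open Summit.HodgeConjecture.HodgeConjecture.Cruxes.H413.F0P3cDyRamTokenSignUnr

namespace Summit.HodgeConjecture.HodgeConjecture.Cruxes.H413.F0P3cDyRamTokenSignClassFree

variable (L : Type) [Field L] [NumberField L] [IsCMField L] {v : HeightOneSpectrum (𝓞 ↥(maximalRealSubfield L))}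
  (w : PlacesOver L v) (hw : IsCMField.complexConj L • w.1 = w.1)

omit [IsCMField L] in
/-- `σx·x = 1` with `σ` isometric ⇒ `|x| = 1`. [folklore] -/
private theorem valued_eq_one_of_map_mul_self' {σ : w.1.adicCompletion L →+* w.1.adicCompletion L} (hσv : ∀ x, Valued.v (σ x) = Valued.v x)
    {x : w.1.adicCompletion L} (h : σ x * x = 1) : Valued.v x = 1 := by
  have hx0 : x ≠ 0 := fun h0 => by rw [h0, mul_zero] at h; exact zero_ne_one h
  have hvx0 : Valued.v x ≠ 0 := (Valuation.ne_zero_iff _).2 hx0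
  have h2 : Valued.v x ^ 2 = 1 := by
    rw [sq]
    nth_rewrite 1 [← hσv x]
    rw [← Valuation.map_mul, h, Valuation.map_one]
  have hlog : log (Valued.v x) = 0 := by
    have h3 := congrArg log h2
    rw [log_pow, log_one] at h3
    simpa using h3
  have h3 : exp (log (Valued.v x)) = Valued.v x := exp_log hvx0
  rw [hlog, exp_zero] at h3
  exact h3.symm

include hw in
/-- **O-Sign, CLASS-FREE: `(β, θ)_v = (a, −θ)_v · (x, a)_v`.**  At a non-split wild ramified `w ∣ v` with datum `(σ_w, ϖ, d, t_E)`: for norm-one `u, D ∈ L_w`, `χ ∈ L_w` non-zero,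
`δ ∈ L_w¹` with `δ² = D`, deep (`|u∕δ − 1| ≤ |ϖ|^n`, `2d + t_E ≤ 2n + 1`, `2t_E < n`), the token `β` (`ι β = −χ(u² + D)∕(2u²D)`), the trace letter `a` (`ι a = (u² + D − χ)∕(uδ) − 2`,
`a ≠ 0`) and the depth token `x` (`ι x = −χ∕(uδ)`):  `(β, θ)_v = (a, −θ)_v · (x, a)_v` — for EVERY descent class (no `hA`).  (`β = x·y`, `(y,θ) = 1`, `x = a − θc²`, ★
`hilbertSymbol_sub_eq_mul_of_sqClass`.) [cite: Rogawski1990, §4.9 p. 55, Lemma 4.9.3 p. 56] [cite: LabesseLanglands1979, §2 (2.1)–(2.2)] [cite: Omeara1963, §63B 63:10–63:13a] -/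
theorem hilbertSymbol_token_eq_mul
    (ϖ : w.1.adicCompletion L) (d tE : ℕ) (hD : IsRamifiedQuadraticDatum (galAdicCompletionMap (L := L) (IsCMField.complexConj L) hw) ϖ d tE)
    {u D χ δ : w.1.adicCompletion L}
    (hσu : galAdicCompletionMap (L := L) (IsCMField.complexConj L) hw u * u = 1)
    (hδ : δ * δ = D) (hσδ : galAdicCompletionMap (L := L) (IsCMField.complexConj L) hw δ * δ = 1) (hχ0 : χ ≠ 0)
    {n : ℕ} (hn : 2 * d + tE ≤ 2 * n + 1) (hn4 : 2 * tE < n) (hdeep : Valued.v (u / δ - 1) ≤ Valued.v ϖ ^ n)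
    {β : v.adicCompletion ↥(maximalRealSubfield L)} (hβ : toPlace v w β = -(χ * (u ^ 2 + D)) / (2 * u ^ 2 * D))
    {a : v.adicCompletion ↥(maximalRealSubfield L)} (ha0 : a ≠ 0) (ha : toPlace v w a = (u ^ 2 + D - χ) / (u * δ) - 2)
    {x : v.adicCompletion ↥(maximalRealSubfield L)} (hx : toPlace v w x = -χ / (u * δ)) :
    hilbertSymbol (v.adicCompletion ↥(maximalRealSubfield L)) β
        (algebraMap ↥(maximalRealSubfield L) _ ((cmQuadraticGenerator L : 𝓞 ↥(maximalRealSubfield L)) : ↥(maximalRealSubfield L))) =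
      hilbertSymbol (v.adicCompletion ↥(maximalRealSubfield L)) a
          (-(algebraMap ↥(maximalRealSubfield L) _ ((cmQuadraticGenerator L : 𝓞 ↥(maximalRealSubfield L)) : ↥(maximalRealSubfield L)))) *
        hilbertSymbol (v.adicCompletion ↥(maximalRealSubfield L)) x a := by
  haveI : CharZero (v.adicCompletion ↥(maximalRealSubfield L)) :=
    charZero_of_injective_algebraMap (algebraMap ↥(maximalRealSubfield L) (v.adicCompletion ↥(maximalRealSubfield L))).injective
  obtain ⟨hσσ, hσv, hϖ, hfix, hϖσ, hd1, h2t⟩ := hD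
  set σ := galAdicCompletionMap (L := L) (IsCMField.complexConj L) hw with hσdef
  set θv : v.adicCompletion ↥(maximalRealSubfield L) :=
    algebraMap ↥(maximalRealSubfield L) _ ((cmQuadraticGenerator L : 𝓞 ↥(maximalRealSubfield L)) : ↥(maximalRealSubfield L)) with hθvdef
  have hι : Function.Injective (toPlace v w) := (toPlace v w).injective
  have hvu : Valued.v u = 1 := valued_eq_one_of_map_mul_self' L w hσv hσu
  have hvδ : Valued.v δ = 1 := valued_eq_one_of_map_mul_self' L w hσv hσδ
  have hu0 : u ≠ 0 := fun h0 => by rw [h0, map_zero] at hvu; exact zero_ne_one hvu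
  have hδ0 : δ ≠ 0 := fun h0 => by rw [h0, map_zero] at hvδ; exact zero_ne_one hvδ
  have hσu' : σ u = u⁻¹ := eq_inv_of_mul_eq_one_left hσu
  have hσδ' : σ δ = δ⁻¹ := eq_inv_of_mul_eq_one_left hσδ
  have h20 : (2 : w.1.adicCompletion L) ≠ 0 := by
    rw [← map_ofNat (algebraMap L (w.1.adicCompletion L)) 2]; exact (map_ne_zero _).2 two_ne_zero
  have hθ0 : θv ≠ 0 := by
    rw [hθvdef, Ne, map_eq_zero_iff _ (algebraMap ↥(maximalRealSubfield L) (v.adicCompletion ↥(maximalRealSubfield L))).injective]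
    exact fun h => not_isSquare_cmQuadraticGenerator L (by rw [h]; exact IsSquare.zero)
  set u' : w.1.adicCompletion L := u / δ with hu'def
  have hu'0 : u' ≠ 0 := div_ne_zero hu0 hδ0
  have hσU : σ u' * u' = 1 := by
    rw [hu'def, map_div₀, div_mul_div_comm, hσu, hσδ, div_one]
  have hσU' : σ u' = u'⁻¹ := eq_inv_of_mul_eq_one_left hσU
  have hvu' : Valued.v u' = 1 := valued_eq_one_of_map_mul_self' L w hσv hσU
  have h4 : Valued.v (u' - 1) < Valued.v (4 : w.1.adicCompletion L) := by
    refine lt_of_le_of_lt hdeep ?_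
    rw [show (4 : w.1.adicCompletion L) = 2 * 2 by norm_num, Valuation.map_mul, h2t, hϖ, ← pow_add, ← exp_nsmul, ← exp_nsmul, exp_lt_exp]
    simp only [nsmul_eq_mul, mul_neg, mul_one, neg_lt_neg_iff]
    have h' : tE + tE < n := by omega
    exact_mod_cast h'
  obtain ⟨r, hrr, hσr, -⟩ := exists_normOne_sqrt L w hw hσv hσU h4
  have hr0 : r ≠ 0 := fun h0 => by rw [h0, mul_zero] at hrr; exact hu'0 hrr.symm
  have hσr' : σ r = r⁻¹ := eq_inv_of_mul_eq_one_left hσr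
  obtain ⟨s, hs0, hσs, hs2⟩ := exists_antifixed_sq_eq_toPlace_cmQuadraticGenerator L w hw
  obtain ⟨c, hc⟩ : ∃ c : v.adicCompletion ↥(maximalRealSubfield L), toPlace v w c = (u' - 1) / (s * r) := by
    refine exists_toPlace_eq_of_fixed L w hw _ ?_
    rw [map_div₀, map_sub, map_one, map_mul, hσU', hσs, hσr', ← hrr]
    field_simp
    ring
  set b : v.adicCompletion ↥(maximalRealSubfield L) := θv * c ^ 2 with hbdef
  have hιb : toPlace v w b = (u' - 1) ^ 2 / u' := by
    rw [hbdef, map_mul, map_pow, hc, hθvdef, ← hs2, ← hrr]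
    field_simp
  -- `x = a − b`
  have hxab : x = a - b := by
    apply hι
    rw [map_sub, hιb, ha, hx, hu'def, ← hδ]
    field_simp
    ring
  have hx0 : x ≠ 0 := fun h0 => by
    have h := hx
    rw [h0, map_zero] at h
    exact div_ne_zero (neg_ne_zero.2 hχ0) (mul_ne_zero hu0 hδ0) h.symm
  have hab : a ≠ b := fun h => hx0 (by rw [hxab]; exact sub_eq_zero.2 h)
  -- `y`, a norm
  obtain ⟨y, hy⟩ : ∃ y : v.adicCompletion ↥(maximalRealSubfield L), toPlace v w y = (u' + u'⁻¹) / 2 := by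
    refine exists_toPlace_eq_of_fixed L w hw _ ?_
    rw [map_div₀, map_add, map_inv₀, hσU', inv_inv, map_ofNat, add_comm]
  have hιy1 : toPlace v w y - 1 = (u' - 1) ^ 2 / (2 * u') := by rw [hy]; field_simp; ring
  have htE2n : tE ≤ 2 * n := by omega
  have hvy1 : Valued.v (toPlace v w y - 1) ≤ Valued.v ϖ ^ (2 * n - tE) := by
    rw [hιy1, Valuation.map_div, Valuation.map_mul, Valuation.map_pow, h2t, hvu', mul_one, hϖ, ← exp_nsmul, ← exp_nsmul,
      div_eq_mul_inv, ← exp_neg]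
    have h1 : Valued.v (u' - 1) ^ 2 ≤ exp (-(n : ℤ)) ^ 2 := by
      have h := hdeep
      rw [hϖ, ← exp_nsmul] at h
      simp only [nsmul_eq_mul, mul_neg, mul_one] at h
      exact pow_le_pow_left' h 2
    calc Valued.v (u' - 1) ^ 2 * exp (-(tE • (-1 : ℤ))) ≤ exp (-(n : ℤ)) ^ 2 * exp (-(tE • (-1 : ℤ))) := by
          gcongr
      _ = exp ((2 * n - tE : ℕ) • (-1 : ℤ)) := by
          rw [← exp_nsmul, ← exp_add]
          congr 1
          simp only [nsmul_eq_mul, mul_neg, mul_one, neg_neg]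
          push_cast [Nat.cast_sub htE2n]
          ring
  have hyθ : hilbertSymbol (v.adicCompletion ↥(maximalRealSubfield L)) y θv = 1 :=
    hilbertSymbol_eq_one_of_valued_toPlace_sub_one_le L w hw ϖ d tE ⟨hσσ, hσv, hϖ, hfix, hϖσ, hd1, h2t⟩ (by omega) hvy1
  have hy0 : y ≠ 0 := by
    rintro rfl
    have h := hvy1
    rw [map_zero, zero_sub, Valuation.map_neg, Valuation.map_one, hϖ, ← exp_nsmul, ← exp_zero, exp_le_exp, nsmul_eq_mul] at h
    have h2 : (1 : ℤ) ≤ ((2 * n - tE : ℕ) : ℤ) := by omega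
    have h3 : ((2 * n - tE : ℕ) : ℤ) * (-1 : ℤ) < 0 := by omega
    exact absurd h (not_le.2 h3)
  have hβxy : β = x * y := by
    apply hι
    rw [map_mul, hx, hy, hu'def, hβ, ← hδ]
    field_simp
  rw [hβxy, hilbertSymbol_adicCompletion_mul_left ↥(maximalRealSubfield L) v hx0 hy0 hθ0, hyθ, mul_one, hxab]
  exact hilbertSymbol_sub_eq_mul_of_sqClass ↥(maximalRealSubfield L) v ha0 hθ0 hbdef.symm.symm hab

end Summit.HodgeConjecture.HodgeConjecture.Cruxes.H413.F0P3cDyRamTokenSignClassFree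

end
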